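import Literature.NumberTheory.Automorphic.ShimuraCurveRibetTakahashi
import Literature.NumberTheory.EllipticCurves.IsogenyIdProofs
import HarnessLib

/-!
# Pasten 2024, Thm. 6.1 (numerator of `γ_{D,M,E}`): the printed telescoping of §6.9,
# performed in the tree

Topic `NumberTheory/Automorphic`; a proofs-only companion (theorems only: no definitions, no named
facts) of `ShimuraCurveRibetTakahashi.lean`, for its named fact
`Literature.NumberTheory.Automorphic.PastenShimura2024_thm_6_1` (H. Pasten, *Shimura curves and
the abc conjecture*, J. Number Theory 254 (2024) = arXiv:1705.09251, Thm. 6.1 p. 20: for `E/ℚ` of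
conductor `N` and an admissible factorisation `N = DM`, the numerator of `γ_{D,M,E}` — defined by
`δ_{1,N}/δ_{D,M} = γ_{D,M,E} · ∏_{p ∣ D} v_p(Δ_E)`, display (6.1) — is supported on primes `≤ 163`
and is at most `163^{ω(D)}`).

The source, §6.9 p. 25 (held arXiv text, read): *"Proof of Theorem 6.1. Consider any factorization
of `N` of the form `N = dprm` where `d` is squarefree with an even number of prime factors, `p` and
`r` are distinct primes not dividing `d`, and `m` is coprime to `dpr`. By Proposition 6.13 and
Lemma 6.8 we have (EqSequentially)
`δ_{d,prm}/δ_{dpr,m} = u_{d,p,r,m}/(i_p(d,prm)² j_r(dpr,m)²) · c_p(E) c_r(E)` where `u_{d,p,r,m}`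
is certain rational number supported on primes `≤ 163` … Repeated applications of this
observation (to sequentially remove prime factors from `D`) give the result regarding the
numerator of `γ_{D,M,E}`. More precisely, choosing a prime factorization `D = p₁r₁⋯pₙrₙ` we apply
the previous analysis to the expression
`δ_{1,N}/δ_{D,M} = δ_{1,N}/δ_{p₁r₁,N/(p₁r₁)} · δ_{p₁r₁,N/(p₁r₁)}/δ_{p₁r₁p₂r₂,N/(p₁r₁p₂r₂)} ⋯
δ_{D/(pₙrₙ),pₙrₙM}/δ_{D,M}`."* Here `c_p(E) = v_p(Δ_E)` (§6.4 p. 22), Prop. 6.13 (p. 23) is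
Ribet–Takahashi's Thm. 2 (`δ_{d,prM}/δ_{dpr,M} = c_p(A_{d,prM}) c_r(A_{dpr,M}) /
(i_p(d,prM)² j_r(dpr,M)²)`, component groups of Néron models of `J₀^d(prM)`, `J₀^{dpr}(M)` and of
the optimal quotients), and Lemma 6.8 (p. 22; Mazur 1978 + Kenku 1982: an isogeny of minimal
degree between `ℚ`-isogenous elliptic curves has degree `≤ 163`) bounds the multiplicative height
of each factor `c_p(A_{d,prM})/c_p(E)`, `c_r(A_{dpr,M})/c_r(E)` of `u` by `163`, so the numerator of
`u` is `≤ 163²` and supported on primes `≤ 163` (whence `163^{2n} = 163^{ω(D)}` in Thm. 6.1).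

What this file proves (sorry-free, no new named fact, no statement of the tree changed):

* `IsAdmissibleFactorization.erase_two_primes` — removing two distinct primes `p, r` from `D`
  gives the admissible factorisation `N = (D/(pr)) · (prM)` with
  `primeFactors D = primeFactors (D/(pr)) ⊔ {p, r}` (Pasten's "`N = dprm`");
* `ShimuraParametrizationData.exists_isMinimalFor_of_nonempty` — an isogeny class with a datum on
  `X` has a datum realising `δ_{D,M}` (`IsMinimalFor`; well-ordering of `ℕ`);
* `PastenShimura2024_thm_6_1_of_eqSequentially` — **Thm. 6.1 (numerator) from (EqSequentially),
  exactly as printed**: the induction on `n = ω(D)/2` removing two primes at a time, multiplying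
  the numerators (`a ≤ 163^{ω(d)} · 163² = 163^{ω(D)}`, primes `≤ 163`) and the discriminant
  exponents (`∏_{q ∣ d} v_q · v_p v_r = ∏_{q ∣ D} v_q`). Its inputs, as explicit hypotheses because
  they are not declarations of the tree: (`hstep`) the two-prime step (EqSequentially) with
  Lemma 6.8 folded in, in the tree's minimal-degree idiom for `δ_{d,prm}` and `δ_{dpr,m}` (module
  docstring of `ShimuraCurveRibetTakahashi.lean`); (`h0`) the case `D = 1`, where Pasten's
  `J₀^1(N) = J₀(N)` (§2 p. 12) makes `δ_{1,N}/δ_{1,N} = 1` a tautology but the tree renders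
  `δ_{1,N}` twice — as the class-minimal degree of classical data `ModularParametrizationData` and
  as the class-minimal degree of Shimura data on a datum `X : ShimuraCurveData 1 N` (an Eichler
  order of level `N` in `M₂(ℚ)`, `Γ` conjugate to `Γ₀(N)`) — and the bridge "the former divides the
  latter" (both equal `δ_{1,N}`: every parametrisation with pull-back in the newform line factors
  through the optimal quotient `q_{1,N}`, §2 p. 12 and proof of Prop. 5.1 p. 17) is what the
  rendered fact asserts at `D = 1`; and the tree's two existence facts `nonempty_shimuraCurveData`,
  `nonempty_shimuraParametrizationData` (the intermediate curves `X₀^d(prm)` and their data);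
* `eqSequentially_of_prop_6_13_of_lemma_6_8` — (EqSequentially) itself from Prop. 6.13
  (= Ribet–Takahashi Thm. 2, with `i_p, j_r ≥ 1` existential and `c_p(A) = v_p(Δ_A)` of the curves
  of the class-minimal data) and Lemma 6.8 (`c_p(A)/c_p(B)` of height `≤ 163` for `ℚ`-isogenous
  curves at a multiplicative prime), both as explicit hypotheses — the first display of §6.9; and
  `PastenShimura2024_thm_6_1_of_prop_6_13_of_lemma_6_8`, the two glued: the fact from Prop. 6.13,
  Lemma 6.8, the `D = 1` bridge and the two existence facts
  (`IsAdmissibleFactorization.dvd_and_not_sq_dvd`: primes of `D` divide `N` exactly once);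
* `div_gcd_dvd_of_comp_eq_nsmul`, `exists_mul_eq_mul_of_comp_eq_nsmul` — the arithmetic of the
  proof of Lemma 6.8 for abstract cyclic groups `ℤ/c_A`, `ℤ/c_B` with maps `f, g`, `g ∘ f = n·`,
  `f ∘ g = n·`: `c_A/gcd(c_A, n) ∣ c_B`, and `c_A · b = a · c_B` with `1 ≤ a, b ≤ n` (so `h68`
  needs beyond it only the functor `Φ_p` and the isogeny of degree `≤ 163`);
* `dvd_deg_of_PastenShimura2024_thm_6_1` — conversely the fact gives back `h0` (at `D = 1` the
  bound `a ≤ 163⁰` forces `a = 1`), so `h0` asks for nothing beyond the fact itself, and the open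
  content of `PastenShimura2024_thm_6_1` beyond its own `D = 1` instance is exactly the two-prime
  step (EqSequentially), i.e. Prop. 6.13 with Lemma 6.8.

The printed consequence (EqUpperRT) `log δ_{1,N} ≤ log δ_{D,M} + log ∏ v_p(Δ_E) + 5.1 ω(D)` of the
fact is in the sibling `ShimuraCurveRibetTakahashiLogFormProofs.lean`
(`PastenShimura2024_thm_6_1.log_le`).

Not attempted: the inputs of (EqSequentially) — Prop. 6.13 = Ribet–Takahashi Thm. 2 (Néron models,
component groups of Jacobians of Shimura curves, Čerednik–Drinfeld and Deligne–Rapoport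
uniformisations, Ribet's exact sequence, Grothendieck's monodromy pairing) and Lemma 6.8 (Mazur's
rational isogeny theorem, Kenku's classification) — and the optimal-quotient description of the
analytic minimal degrees; none of that vocabulary exists in Mathlib or `Literature/` yet; the
discharge `PastenShimura2024_thm_6_1_holds` waits for them.

## References

* H. Pasten, *Shimura curves and the abc conjecture*, J. Number Theory 254 (2024) 214–335 =
  arXiv:1705.09251: §2 p. 12, Thm. 6.1 p. 20, §6.4 and Lemma 6.8 p. 22, Prop. 6.13 p. 23, §6.9
  p. 25 ((EqSequentially) and the telescoping). [PastenShimura2024]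
* K. A. Ribet, S. Takahashi, *Parametrizations of elliptic curves by Shimura curves and by
  classical modular curves*, PNAS 94 (1997) 11110–11114, Thm. 2. [RibetTakahashi1997]
* B. Mazur, *Rational isogenies of prime degree*, Invent. Math. 44 (1978). [Mazur1978]
* M. A. Kenku, *On the number of `ℚ`-isomorphism classes of elliptic curves in each `ℚ`-isogeny
  class*, J. Number Theory 15 (1982). [Kenku1982]
-/

noncomputable section

open scoped MatrixGroups ModularForm

namespace Literature.NumberTheory.Automorphic

open Literature.NumberTheory.EllipticCurves.ModularForms (ModularParametrizationData IsNewformOf)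

/-! ### Removing two primes from `D` -/

/-- **Pasten's "`N = dprm`" (§6.9 p. 25).** If `N = DM` is admissible and `p ≠ r` are primes
dividing `D`, then with `d = D/(pr)`: `D = d · (pr)`, `N = d · (prM)` is admissible (`d` is
squarefree with an even number of prime factors and coprime to `prM`), and the prime factors of `D`
are those of `d` together with `p, r` (disjointly). [cite: PastenShimura2024, §6.9 p. 25 (proof of Thm. 6.1, "N = dprm")] -/
theorem IsAdmissibleFactorization.erase_two_primes {N D M p r : ℕ}
    (h : IsAdmissibleFactorization N D M) (hp : p.Prime) (hr : r.Prime) (hpr : p ≠ r)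
    (hpD : p ∣ D) (hrD : r ∣ D) :
    D = D / (p * r) * (p * r) ∧ IsAdmissibleFactorization N (D / (p * r)) (p * r * M) ∧
      Disjoint (D / (p * r)).primeFactors {p, r} ∧
      D.primeFactors = (D / (p * r)).primeFactors ∪ {p, r} := by
  have hprD : p * r ∣ D :=
    Nat.Coprime.mul_dvd_of_dvd_of_dvd ((Nat.coprime_primes hp hr).mpr hpr) hpD hrD
  set d := D / (p * r) with hd
  have hD : D = d * (p * r) := (Nat.div_mul_cancel hprD).symm
  have hsq : (d.Coprime (p * r)) ∧ Squarefree d ∧ Squarefree (p * r) := by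
    rw [← Nat.squarefree_mul_iff, ← hD]
    exact h.squarefree
  obtain ⟨hcop, hsqd, -⟩ := hsq
  have hpf_pr : (p * r).primeFactors = {p, r} := by
    rw [Nat.primeFactors_mul hp.ne_zero hr.ne_zero, hp.primeFactors, hr.primeFactors,
      ← Finset.insert_eq]
  have hdisj : Disjoint d.primeFactors {p, r} := hpf_pr ▸ hcop.disjoint_primeFactors
  have hpf : D.primeFactors = d.primeFactors ∪ {p, r} := by
    rw [hD, hcop.primeFactors_mul, hpf_pr]
  refine ⟨hD, ⟨h.pos, ?_, hsqd, ?_, ?_⟩, hdisj, hpf⟩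
  · rw [← h.mul_eq, hD]; ring
  · have hcard : D.primeFactors.card = d.primeFactors.card + 2 := by
      rw [hpf, Finset.card_union_of_disjoint hdisj, Finset.card_pair hpr]
    have heven := h.even_card_primeFactors
    rw [hcard, Nat.even_add] at heven
    exact heven.mpr even_two
  · exact Nat.Coprime.mul_right hcop (Nat.Coprime.coprime_dvd_left ⟨p * r, hD⟩ h.coprime)

/-! ### Class-minimal Shimura parametrisation data exist -/

/-- **An isogeny class with a Shimura parametrisation datum on `X` has a datum realising
`δ_{D,M}`** (`ShimuraParametrizationData.IsMinimalFor`): the degrees of the data on `X` of the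
curves `ℚ`-isogenous to `W` form a non-empty set of naturals (`W ∼ W`, the given datum), which has
a least element. [folklore] -/
theorem ShimuraParametrizationData.exists_isMinimalFor_of_nonempty {D M : ℕ}
    {X : ShimuraCurveData D M} {W : WeierstrassCurve ℚ} [W.IsElliptic]
    (hP : Nonempty (ShimuraParametrizationData X W)) :
    ∃ (W' : WeierstrassCurve ℚ) (_ : W'.IsElliptic) (P' : ShimuraParametrizationData X W'),
      P'.IsMinimalFor W := by
  classical
  obtain ⟨P⟩ := hP
  have hex : ∃ n, ∃ (W' : WeierstrassCurve ℚ) (_ : W'.IsElliptic)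
      (P' : ShimuraParametrizationData X W'), W.IsIsogenous W' ∧ P'.deg = n :=
    ⟨_, W, inferInstance, P, WeierstrassCurve.isIsogenous_self W, rfl⟩
  obtain ⟨W', hW', P', hiso, hP'⟩ := Nat.find_spec hex
  refine ⟨W', hW', P', hiso, fun W'' _ P'' hiso'' => ?_⟩
  rw [hP']
  exact Nat.find_min' hex ⟨W'', inferInstance, P'', hiso'', rfl⟩

/-! ### Thm. 6.1 (numerator) from (EqSequentially): the telescoping of §6.9 -/

/-- **Pasten 2024, Thm. 6.1 (numerator of `γ_{D,M,E}`) from (EqSequentially) — the printed proof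
(§6.9 p. 25: "Repeated applications of this observation (to sequentially remove prime factors from
`D`) give the result regarding the numerator of `γ_{D,M,E}`").** Inputs:

* (`hstep`) **(EqSequentially) with Lemma 6.8**, in the tree's idiom: for `N = DM` admissible,
  `D = d · pr` with `p ≠ r` primes, `E` rendered as a globally minimal `W` of conductor `N`, a datum
  `P₁` realising `δ_{d,prM}` (class-minimal on some `X₁ : ShimuraCurveData d (prM)`) and a datum
  `P₂` realising `δ_{D,M}` (class-minimal on some `X₂ : ShimuraCurveData D M`):
  `δ_{d,prM} · b = a · δ_{D,M} · v_p(Δ_E) v_r(Δ_E)` for some `a, b ≥ 1` with `a ≤ 163²` supported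
  on primes `≤ 163` — i.e. `δ_{d,prM}/δ_{D,M} = u/(i_p² j_r²) · c_p(E) c_r(E)` (Prop. 6.13 =
  Ribet–Takahashi Thm. 2, and `c_p(E) = v_p(Δ_E)`, §6.4) with the numerator of
  `u = (c_p(A_{d,prM})/c_p(E)) · (c_r(A_{D,M})/c_r(E))` at most `163 · 163` and supported on primes
  `≤ 163` (Lemma 6.8, twice);
* (`h0`) **the case `D = 1`** (`J₀^1(N) = J₀(N)`, §2 p. 12): the class-minimal degree of classical
  data with the newform of `W` divides the class-minimal degree of Shimura data on any
  `X : ShimuraCurveData 1 N` (both are `δ_{1,N}`; this is what the fact renders at `D = 1`, and the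
  fact gives it back: `dvd_deg_of_PastenShimura2024_thm_6_1`);
* (`hX`, `hP`) the tree's named facts `nonempty_shimuraCurveData` (the curves `X₀^d(prM)` exist)
  and `nonempty_shimuraParametrizationData` (Jacquet–Langlands data of `W` on them exist).

Proof: induction on `n = ω(D)/2` for fixed `N, W, D₁`. `n = 0`: `D = 1`, `M = N`, take `a = 1` and
`b = δ/δ_{1,N}` from `h0`. `n + 1`: pick primes `p ≠ r` of `D`, `d = D/(pr)`
(`IsAdmissibleFactorization.erase_two_primes`), a curve `X₁` of level `(d, prM)` (`hX`) and a
class-minimal datum `P₁` on it (`hP`, `exists_isMinimalFor_of_nonempty`); the induction hypothesis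
gives `δ_{1,N} b₁ = a₁ · deg P₁ · ∏_{q ∣ d} v_q` with `a₁ ≤ 163^{ω(d)}`, `hstep` gives
`deg P₁ · b₂ = a₂ · deg P · v_p v_r` with `a₂ ≤ 163²`; multiply: `a = a₁a₂ ≤ 163^{ω(d)+2} =
163^{ω(D)}`, primes of `a` are `≤ 163`, `b = b₁b₂`, and `∏_{q ∣ d} v_q · v_p v_r = ∏_{q ∣ D} v_q`.
[cite: PastenShimura2024, Thm. 6.1 p. 20 and its proof §6.9 p. 25 ((EqSequentially), telescoping), with Prop. 6.13 p. 23 and Lemma 6.8 p. 22] -/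
theorem PastenShimura2024_thm_6_1_of_eqSequentially
    (hX : nonempty_shimuraCurveData) (hP : nonempty_shimuraParametrizationData)
    (h0 : ∀ {N : ℕ} [NeZero N] (X : ShimuraCurveData 1 N) (W : WeierstrassCurve ℚ) [W.IsElliptic]
      [W.IsGloballyMinimal], W.conductorNorm ℤ = N →
      ∀ (W₁ : WeierstrassCurve ℚ) [W₁.IsElliptic] (D₁ : ModularParametrizationData W₁ N),
        IsNewformOf W D₁.f →
        (∀ (W₂ : WeierstrassCurve ℚ) [W₂.IsElliptic] (D₂ : ModularParametrizationData W₂ N),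
            D₂.f = D₁.f → D₁.modularDegree ≤ D₂.modularDegree) →
      ∀ (W' : WeierstrassCurve ℚ) [W'.IsElliptic] (P : ShimuraParametrizationData X W'),
        P.IsMinimalFor W → D₁.modularDegree ∣ P.deg)
    (hstep : ∀ {N D M d p r : ℕ}, p.Prime → r.Prime → p ≠ r → D = d * (p * r) →
      IsAdmissibleFactorization N D M →
      ∀ (X₁ : ShimuraCurveData d (p * r * M)) (X₂ : ShimuraCurveData D M)
        (W : WeierstrassCurve ℚ) [W.IsElliptic] [W.IsGloballyMinimal], W.conductorNorm ℤ = N →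
      ∀ (W₁' : WeierstrassCurve ℚ) [W₁'.IsElliptic] (P₁ : ShimuraParametrizationData X₁ W₁'),
        P₁.IsMinimalFor W →
      ∀ (W₂' : WeierstrassCurve ℚ) [W₂'.IsElliptic] (P₂ : ShimuraParametrizationData X₂ W₂'),
        P₂.IsMinimalFor W →
        ∃ a b : ℕ, 0 < a ∧ 0 < b ∧ a ≤ 163 ^ 2 ∧ (∀ q ∈ a.primeFactors, q ≤ 163) ∧
          P₁.deg * b = a * P₂.deg *
            ((W.minimalDiscriminantNorm ℤ).factorization p *
              (W.minimalDiscriminantNorm ℤ).factorization r)) :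
    PastenShimura2024_thm_6_1 := by
  intro N D M _ hadm X W _ _ hWN W₁ _ D₁ hf hmin W' _ P hPmin
  -- the printed induction on `n = ω(D)/2`, for fixed `N`, `W` (= `E`) and `δ_{1,N}` (= `D₁`)
  obtain ⟨n, hn⟩ := hadm.even_card_primeFactors
  induction n generalizing D M W' with
  | zero =>
    -- `D = 1`, `M = N`: `δ_{1,N} ∣ deg P` (`h0`), take `a = 1`
    have hD : D = 1 := by
      have h1 := Nat.primeFactors_eq_empty.mp (Finset.card_eq_zero.mp hn)
      exact h1.resolve_left hadm.squarefree.ne_zero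
    subst hD
    obtain rfl : M = N := by simpa using hadm.mul_eq
    obtain ⟨b, hb⟩ := h0 X W hWN W₁ D₁ hf hmin W' P hPmin
    refine ⟨1, b, Nat.one_pos, Nat.pos_of_ne_zero ?_, by simp, by simp, ?_⟩
    · rintro rfl
      exact P.deg_pos.ne' (by simpa using hb)
    · simp [hb]
  | succ n ih =>
    -- two primes `p ≠ r` of `D`, `d = D/(pr)`
    obtain ⟨p, hp⟩ : D.primeFactors.Nonempty := Finset.card_pos.mp (by omega)
    obtain ⟨r, hr⟩ : (D.primeFactors.erase p).Nonempty :=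
      Finset.card_pos.mp (by rw [Finset.card_erase_of_mem hp]; omega)
    obtain ⟨hrp, hr⟩ := Finset.mem_erase.mp hr
    have hpp : p.Prime := Nat.prime_of_mem_primeFactors hp
    have hrr : r.Prime := Nat.prime_of_mem_primeFactors hr
    obtain ⟨hDd, hadm₁, hdisj, hpf⟩ :=
      hadm.erase_two_primes hpp hrr (Ne.symm hrp) (Nat.dvd_of_mem_primeFactors hp)
        (Nat.dvd_of_mem_primeFactors hr)
    set d := D / (p * r) with hd
    have hcard : D.primeFactors.card = d.primeFactors.card + 2 := by
      rw [hpf, Finset.card_union_of_disjoint hdisj, Finset.card_pair (Ne.symm hrp)]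
    -- the curve `X₀^d(prM)` and a datum realising `δ_{d,prM}`
    obtain ⟨X₁⟩ := hX hadm₁
    obtain ⟨W₁', hW₁', P₁, hP₁min⟩ :=
      ShimuraParametrizationData.exists_isMinimalFor_of_nonempty (hP hadm₁ X₁ W hWN)
    -- induction hypothesis at level `(d, prM)` and the two-prime step
    obtain ⟨a₁, b₁, ha₁, hb₁, ha₁le, ha₁p, h₁⟩ := ih hadm₁ X₁ W₁' P₁ hP₁min (by omega)
    obtain ⟨a₂, b₂, ha₂, hb₂, ha₂le, ha₂p, h₂⟩ :=
      hstep hpp hrr (Ne.symm hrp) hDd hadm X₁ X W hWN W₁' P₁ hP₁min W' P hPmin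
    refine ⟨a₁ * a₂, b₁ * b₂, Nat.mul_pos ha₁ ha₂, Nat.mul_pos hb₁ hb₂, ?_, ?_, ?_⟩
    · rw [hcard, pow_add]
      exact Nat.mul_le_mul ha₁le ha₂le
    · intro q hq
      rw [Nat.primeFactors_mul ha₁.ne' ha₂.ne', Finset.mem_union] at hq
      exact hq.elim (ha₁p q) (ha₂p q)
    · rw [hpf, Finset.prod_union hdisj, Finset.prod_pair (Ne.symm hrp)]
      set V := ∏ q ∈ d.primeFactors, (W.minimalDiscriminantNorm ℤ).factorization q
      set vp := (W.minimalDiscriminantNorm ℤ).factorization p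
      set vr := (W.minimalDiscriminantNorm ℤ).factorization r
      calc D₁.modularDegree * (b₁ * b₂) = D₁.modularDegree * b₁ * b₂ := by ring
        _ = a₁ * P₁.deg * V * b₂ := by rw [h₁]
        _ = a₁ * V * (P₁.deg * b₂) := by ring
        _ = a₁ * V * (a₂ * P.deg * (vp * vr)) := by rw [h₂]
        _ = a₁ * a₂ * P.deg * (V * (vp * vr)) := by ring

/-! ### Conversely: the fact gives back its `D = 1` instance `h0` -/

/-- **The fact implies its `D = 1` input** (so the hypothesis `h0` of
`PastenShimura2024_thm_6_1_of_eqSequentially` asks for nothing beyond the fact): at the admissible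
factorisation `N = 1 · N` the fact gives `δ_{1,N} · b = a · deg P` with `a ≤ 163⁰ = 1`, i.e.
`δ_{1,N} ∣ deg P` for every class-minimal Shimura datum `P` on a curve `X : ShimuraCurveData 1 N`
(Pasten: `J₀^1(N) = J₀(N)`, §2 p. 12, so both numbers are `δ_{1,N}`).
[cite: PastenShimura2024, Thm. 6.1 p. 20 (case D = 1) with §2 p. 12] -/
theorem dvd_deg_of_PastenShimura2024_thm_6_1 (h : PastenShimura2024_thm_6_1) {N : ℕ} [NeZero N]
    (X : ShimuraCurveData 1 N) (W : WeierstrassCurve ℚ) [W.IsElliptic] [W.IsGloballyMinimal]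
    (hWN : W.conductorNorm ℤ = N) (W₁ : WeierstrassCurve ℚ) [W₁.IsElliptic]
    (D₁ : ModularParametrizationData W₁ N) (hf : IsNewformOf W D₁.f)
    (hmin : ∀ (W₂ : WeierstrassCurve ℚ) [W₂.IsElliptic] (D₂ : ModularParametrizationData W₂ N),
      D₂.f = D₁.f → D₁.modularDegree ≤ D₂.modularDegree)
    (W' : WeierstrassCurve ℚ) [W'.IsElliptic] (P : ShimuraParametrizationData X W')
    (hP : P.IsMinimalFor W) : D₁.modularDegree ∣ P.deg := by
  obtain ⟨a, b, ha, -, hale, -, hab⟩ :=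
    h (isAdmissibleFactorization_one (NeZero.pos N)) X W hWN W₁ D₁ hf hmin W' P hP
  have ha1 : a = 1 := le_antisymm (by simpa using hale) ha
  subst ha1
  exact ⟨b, by simpa using hab.symm⟩

/-! ### (EqSequentially) from Prop. 6.13 and Lemma 6.8 (§6.9, first display) -/

/-- **A prime of `D` divides the conductor exactly once** (`p ∣ D`, `D` squarefree and coprime to
`M`, `N = DM`): `p ∣ N` and `p² ∤ N` — "the primes `p ∣ D` are of multiplicative reduction".
[cite: PastenShimura2024, §2 p. 12 (admissible factorization)] -/
theorem IsAdmissibleFactorization.dvd_and_not_sq_dvd {N D M p : ℕ}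
    (h : IsAdmissibleFactorization N D M) (hp : p.Prime) (hpD : p ∣ D) :
    p ∣ N ∧ ¬ p ^ 2 ∣ N := by
  refine ⟨hpD.trans ⟨M, h.mul_eq.symm⟩, fun h2 => ?_⟩
  rw [← h.mul_eq] at h2
  -- `p ∤ M` (coprimality), so `p² ∣ D`, contradicting squarefreeness
  have hpM : (p ^ 2).Coprime M :=
    Nat.Coprime.pow_left 2 (Nat.Coprime.coprime_dvd_left hpD h.coprime)
  have hp2D : p * p ∣ D := by simpa [sq] using hpM.dvd_of_dvd_mul_right h2
  exact hp.prime.not_unit (h.squarefree p hp2D)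

/-- **(EqSequentially) from Prop. 6.13 and Lemma 6.8 — the first display of §6.9 (p. 25: "By
Proposition 6.13 and Lemma 6.8 we have
`δ_{d,prm}/δ_{dpr,m} = u_{d,p,r,m}/(i_p(d,prm)² j_r(dpr,m)²) · c_p(E) c_r(E)` where `u_{d,p,r,m}` is
certain rational number supported on primes `≤ 163`").** Inputs, as explicit hypotheses because
they are not declarations of the tree:

* (`h613`) **Prop. 6.13 = Ribet–Takahashi 1997, Thm. 2** (p. 23: "`δ_{d,prM}/δ_{dpr,M} =
  c_p(A_{d,prM}) · c_r(A_{dpr,M}) / (i_p(d,prM)² · j_r(dpr,M)²)`", with `i_p = # image`,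
  `j_r = # cokernel` of `q_{·,·,p,*}` on component groups, §6.6, and `c_p(A) := v_p(Δ_A)`, §6.4),
  in the tree's idiom and with `i_p, j_r ≥ 1` existentially quantified (the tree has no component
  groups of Néron models): `A_{d,prM}`, `A_{dpr,M}` are the curves `W₁'`, `W₂'` of data realising
  `δ_{d,prM}`, `δ_{dpr,M}` (`IsMinimalFor`), `c_p(A) = v_p` of the minimal discriminant
  (`minimalDiscriminantNorm`, model-independent);
* (`h68`) **Lemma 6.8** (p. 22: "Let `A` and `B` be elliptic curves which are isogenous over `ℚ`
  and suppose that `p` is a prime of multiplicative reduction for one (hence both) of them. Then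
  `c_p(A)/c_p(B)` is a rational number whose multiplicative height is at most `163`"; proof: Mazur
  1978 + Kenku 1982, a minimal isogeny has degree `n ≤ 163`, and functoriality of `Φ_p`), rendered:
  `W ∼ W'` over `ℚ`, `p ∥ N_W` (multiplicative reduction) ⇒ `c_p(W') · b = a · c_p(W)` for some
  `1 ≤ a, b ≤ 163`.

Proof (as printed): `δ_{d,prM} i² j² = δ_{D,M} c_p(A₁) c_r(A₂)`, `c_p(A₁) b₁ = a₁ c_p(E)`,
`c_r(A₂) b₂ = a₂ c_r(E)` give `δ_{d,prM} · (i²j² b₁b₂) = (a₁a₂) · δ_{D,M} · c_p(E) c_r(E)` with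
`a₁a₂ ≤ 163²` whose prime factors are `≤ max(a₁, a₂) ≤ 163`; the primes `p, r ∣ D` divide `N`
exactly once (`IsAdmissibleFactorization.dvd_and_not_sq_dvd`). The conclusion is literally the
hypothesis `hstep` of `PastenShimura2024_thm_6_1_of_eqSequentially`.
[cite: PastenShimura2024, §6.9 p. 25 ((EqSequentially)), Prop. 6.13 p. 23, Lemma 6.8 p. 22] -/
theorem eqSequentially_of_prop_6_13_of_lemma_6_8
    (h613 : ∀ {N D M d p r : ℕ}, p.Prime → r.Prime → p ≠ r → D = d * (p * r) →
      IsAdmissibleFactorization N D M →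
      ∀ (X₁ : ShimuraCurveData d (p * r * M)) (X₂ : ShimuraCurveData D M)
        (W : WeierstrassCurve ℚ) [W.IsElliptic] [W.IsGloballyMinimal], W.conductorNorm ℤ = N →
      ∀ (W₁' : WeierstrassCurve ℚ) [W₁'.IsElliptic] (P₁ : ShimuraParametrizationData X₁ W₁'),
        P₁.IsMinimalFor W →
      ∀ (W₂' : WeierstrassCurve ℚ) [W₂'.IsElliptic] (P₂ : ShimuraParametrizationData X₂ W₂'),
        P₂.IsMinimalFor W →
        ∃ i j : ℕ, 0 < i ∧ 0 < j ∧
          P₁.deg * (i ^ 2 * j ^ 2) = P₂.deg *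
            ((W₁'.minimalDiscriminantNorm ℤ).factorization p *
              (W₂'.minimalDiscriminantNorm ℤ).factorization r))
    (h68 : ∀ (W W' : WeierstrassCurve ℚ) [W.IsElliptic] [W'.IsElliptic], W.IsIsogenous W' →
      ∀ p : ℕ, p.Prime → p ∣ W.conductorNorm ℤ → ¬ p ^ 2 ∣ W.conductorNorm ℤ →
        ∃ a b : ℕ, 0 < a ∧ a ≤ 163 ∧ 0 < b ∧ b ≤ 163 ∧
          (W'.minimalDiscriminantNorm ℤ).factorization p * b =
            a * (W.minimalDiscriminantNorm ℤ).factorization p)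
    {N D M d p r : ℕ} (hp : p.Prime) (hr : r.Prime) (hpr : p ≠ r) (hD : D = d * (p * r))
    (hadm : IsAdmissibleFactorization N D M)
    (X₁ : ShimuraCurveData d (p * r * M)) (X₂ : ShimuraCurveData D M)
    (W : WeierstrassCurve ℚ) [W.IsElliptic] [W.IsGloballyMinimal] (hWN : W.conductorNorm ℤ = N)
    (W₁' : WeierstrassCurve ℚ) [W₁'.IsElliptic] (P₁ : ShimuraParametrizationData X₁ W₁')
    (hP₁ : P₁.IsMinimalFor W)
    (W₂' : WeierstrassCurve ℚ) [W₂'.IsElliptic] (P₂ : ShimuraParametrizationData X₂ W₂')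
    (hP₂ : P₂.IsMinimalFor W) :
    ∃ a b : ℕ, 0 < a ∧ 0 < b ∧ a ≤ 163 ^ 2 ∧ (∀ q ∈ a.primeFactors, q ≤ 163) ∧
      P₁.deg * b = a * P₂.deg *
        ((W.minimalDiscriminantNorm ℤ).factorization p *
          (W.minimalDiscriminantNorm ℤ).factorization r) := by
  -- `p, r ∣ D` are multiplicative for `E`: `p ∥ N`, `r ∥ N`
  have hpD : p ∣ D := ⟨d * r, by rw [hD]; ring⟩
  have hrD : r ∣ D := ⟨d * p, by rw [hD]; ring⟩
  obtain ⟨hpN, hp2N⟩ := hadm.dvd_and_not_sq_dvd hp hpD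
  obtain ⟨hrN, hr2N⟩ := hadm.dvd_and_not_sq_dvd hr hrD
  rw [← hWN] at hpN hp2N hrN hr2N
  -- Prop. 6.13 and Lemma 6.8 (twice)
  obtain ⟨i, j, hi, hj, h13⟩ := h613 hp hr hpr hD hadm X₁ X₂ W hWN W₁' P₁ hP₁ W₂' P₂ hP₂
  obtain ⟨a₁, b₁, ha₁, ha₁le, hb₁, -, h₁⟩ := h68 W W₁' hP₁.1 p hp hpN hp2N
  obtain ⟨a₂, b₂, ha₂, ha₂le, hb₂, -, h₂⟩ := h68 W W₂' hP₂.1 r hr hrN hr2N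
  refine ⟨a₁ * a₂, i ^ 2 * j ^ 2 * (b₁ * b₂), Nat.mul_pos ha₁ ha₂,
    Nat.mul_pos (Nat.mul_pos (pow_pos hi 2) (pow_pos hj 2)) (Nat.mul_pos hb₁ hb₂), ?_, ?_, ?_⟩
  · rw [sq]
    exact Nat.mul_le_mul ha₁le ha₂le
  · intro q hq
    rw [Nat.primeFactors_mul ha₁.ne' ha₂.ne', Finset.mem_union] at hq
    exact hq.elim (fun h => (Nat.le_of_mem_primeFactors h).trans ha₁le)
      fun h => (Nat.le_of_mem_primeFactors h).trans ha₂le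
  · set c₁ := (W₁'.minimalDiscriminantNorm ℤ).factorization p
    set c₂ := (W₂'.minimalDiscriminantNorm ℤ).factorization r
    set vp := (W.minimalDiscriminantNorm ℤ).factorization p
    set vr := (W.minimalDiscriminantNorm ℤ).factorization r
    calc P₁.deg * (i ^ 2 * j ^ 2 * (b₁ * b₂)) = P₁.deg * (i ^ 2 * j ^ 2) * (b₁ * b₂) := by ring
      _ = P₂.deg * (c₁ * c₂) * (b₁ * b₂) := by rw [h13]
      _ = P₂.deg * ((c₁ * b₁) * (c₂ * b₂)) := by ring
      _ = P₂.deg * ((a₁ * vp) * (a₂ * vr)) := by rw [h₁, h₂]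
      _ = a₁ * a₂ * P₂.deg * (vp * vr) := by ring

/-- **Pasten 2024, Thm. 6.1 (numerator) from Prop. 6.13 and Lemma 6.8** — the whole printed proof
of the numerator statement (§6.9 p. 25) performed in the tree: (EqSequentially) from Prop. 6.13
(= Ribet–Takahashi Thm. 2, `h613`) and Lemma 6.8 (Mazur–Kenku, `h68`)
(`eqSequentially_of_prop_6_13_of_lemma_6_8`), then the telescoping
(`PastenShimura2024_thm_6_1_of_eqSequentially`, with the `D = 1` bridge `h0` and the existence
facts `nonempty_shimuraCurveData`, `nonempty_shimuraParametrizationData`). What remains open for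
`PastenShimura2024_thm_6_1_holds` is exactly `h613`, `h68`, `h0`.
[cite: PastenShimura2024, Thm. 6.1 p. 20, proof §6.9 p. 25, Prop. 6.13 p. 23, Lemma 6.8 p. 22] -/
theorem PastenShimura2024_thm_6_1_of_prop_6_13_of_lemma_6_8
    (hX : nonempty_shimuraCurveData) (hP : nonempty_shimuraParametrizationData)
    (h0 : ∀ {N : ℕ} [NeZero N] (X : ShimuraCurveData 1 N) (W : WeierstrassCurve ℚ) [W.IsElliptic]
      [W.IsGloballyMinimal], W.conductorNorm ℤ = N →
      ∀ (W₁ : WeierstrassCurve ℚ) [W₁.IsElliptic] (D₁ : ModularParametrizationData W₁ N),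
        IsNewformOf W D₁.f →
        (∀ (W₂ : WeierstrassCurve ℚ) [W₂.IsElliptic] (D₂ : ModularParametrizationData W₂ N),
            D₂.f = D₁.f → D₁.modularDegree ≤ D₂.modularDegree) →
      ∀ (W' : WeierstrassCurve ℚ) [W'.IsElliptic] (P : ShimuraParametrizationData X W'),
        P.IsMinimalFor W → D₁.modularDegree ∣ P.deg)
    (h613 : ∀ {N D M d p r : ℕ}, p.Prime → r.Prime → p ≠ r → D = d * (p * r) →
      IsAdmissibleFactorization N D M →
      ∀ (X₁ : ShimuraCurveData d (p * r * M)) (X₂ : ShimuraCurveData D M)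
        (W : WeierstrassCurve ℚ) [W.IsElliptic] [W.IsGloballyMinimal], W.conductorNorm ℤ = N →
      ∀ (W₁' : WeierstrassCurve ℚ) [W₁'.IsElliptic] (P₁ : ShimuraParametrizationData X₁ W₁'),
        P₁.IsMinimalFor W →
      ∀ (W₂' : WeierstrassCurve ℚ) [W₂'.IsElliptic] (P₂ : ShimuraParametrizationData X₂ W₂'),
        P₂.IsMinimalFor W →
        ∃ i j : ℕ, 0 < i ∧ 0 < j ∧
          P₁.deg * (i ^ 2 * j ^ 2) = P₂.deg *
            ((W₁'.minimalDiscriminantNorm ℤ).factorization p *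
              (W₂'.minimalDiscriminantNorm ℤ).factorization r))
    (h68 : ∀ (W W' : WeierstrassCurve ℚ) [W.IsElliptic] [W'.IsElliptic], W.IsIsogenous W' →
      ∀ p : ℕ, p.Prime → p ∣ W.conductorNorm ℤ → ¬ p ^ 2 ∣ W.conductorNorm ℤ →
        ∃ a b : ℕ, 0 < a ∧ a ≤ 163 ∧ 0 < b ∧ b ≤ 163 ∧
          (W'.minimalDiscriminantNorm ℤ).factorization p * b =
            a * (W.minimalDiscriminantNorm ℤ).factorization p) :
    PastenShimura2024_thm_6_1 :=
  PastenShimura2024_thm_6_1_of_eqSequentially hX hP h0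
    fun hp hr hpr hD hadm X₁ X₂ W _ _ hWN W₁' _ P₁ hP₁ W₂' _ P₂ hP₂ =>
      eqSequentially_of_prop_6_13_of_lemma_6_8 h613 h68 hp hr hpr hD hadm X₁ X₂ W hWN W₁' P₁ hP₁
        W₂' P₂ hP₂

/-! ### The arithmetic of the proof of Lemma 6.8 (component groups as abstract cyclic groups) -/

/-- **The divisibility in the proof of Lemma 6.8** (p. 22: with `Φ_p(A) = ℤ/c_p(A)ℤ`,
`Φ_p(B) = ℤ/c_p(B)ℤ` and `β α = [n]`, "`c_p(A)/(n, c_p(A)) = # im(n·)` divides `# im(β_{p,*})`,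
which divides `c_p(B)`"), for abstract cyclic groups: if `f : ℤ/c_A → ℤ/c_B` and
`g : ℤ/c_B → ℤ/c_A` are additive maps with `g ∘ f = n·`, then `c_A / gcd(c_A, n) ∣ c_B`. Indeed
`n = g(f(1))` lies in the image of `g`, so its order `c_A/gcd(c_A, n)` divides `# im g`, which
divides `#(ℤ/c_B) = c_B`.
[cite: PastenShimura2024, Lemma 6.8 p. 22 (proof)] -/
theorem div_gcd_dvd_of_comp_eq_nsmul {cA cB : ℕ} [NeZero cA] [NeZero cB] (n : ℕ)
    (f : ZMod cA →+ ZMod cB) (g : ZMod cB →+ ZMod cA) (hgf : ∀ x, g (f x) = n • x) :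
    cA / Nat.gcd cA n ∣ cB := by
  have hmem : ((n : ℕ) : ZMod cA) ∈ g.range := ⟨f 1, by rw [hgf, nsmul_eq_mul, mul_one]⟩
  have h1 : addOrderOf ((n : ℕ) : ZMod cA) = cA / Nat.gcd cA n :=
    ZMod.addOrderOf_coe n (NeZero.ne cA)
  have h2 : addOrderOf ((n : ℕ) : ZMod cA) ∣ Nat.card g.range := by
    rw [← AddSubgroup.addOrderOf_mk _ hmem]
    exact addOrderOf_dvd_natCard _
  have h3 : Nat.card g.range ∣ cB := by
    have h := AddSubgroup.card_dvd_of_surjective g.rangeRestrict g.rangeRestrict_surjective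
    rwa [Nat.card_zmod] at h
  exact h1 ▸ h2.trans h3

/-- **Lemma 6.8 for abstract component groups** (the printed proof, p. 22: "Thus, the numerator of
`c_p(A)/c_p(B)` divides `n`, and similarly for the denominator using `αβ` instead"): if
`f : ℤ/c_A → ℤ/c_B`, `g : ℤ/c_B → ℤ/c_A` are additive maps with `g ∘ f = n·` and `f ∘ g = n·`
(`α_{p,*}`, `β_{p,*}` for an isogeny `α` of degree `n` and its dual `β`), `c_A, c_B, n ≥ 1`, then
`c_A/c_B = a/b` with `1 ≤ a, b ≤ n` (namely its lowest terms: numerator and denominator divide `n`),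
i.e. `c_A · b = a · c_B`. With `n ≤ 163` (Mazur–Kenku) this is the shape of the hypothesis `h68` of
`eqSequentially_of_prop_6_13_of_lemma_6_8`; what that hypothesis still needs beyond this theorem is
the component-group functor `Φ_p` itself (`Φ_p(A)` cyclic of order `v_p(Δ_A)` at a multiplicative
prime, `[n]_{p,*} = n·`) and the isogeny of degree `≤ 163`.
[cite: PastenShimura2024, Lemma 6.8 p. 22 (proof)] -/
theorem exists_mul_eq_mul_of_comp_eq_nsmul {cA cB n : ℕ} (hA : 0 < cA) (hB : 0 < cB) (hn : 0 < n)
    (f : ZMod cA →+ ZMod cB) (g : ZMod cB →+ ZMod cA) (hgf : ∀ x, g (f x) = n • x)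
    (hfg : ∀ y, f (g y) = n • y) :
    ∃ a b : ℕ, 0 < a ∧ a ≤ n ∧ 0 < b ∧ b ≤ n ∧ cA * b = a * cB := by
  haveI : NeZero cA := ⟨hA.ne'⟩
  haveI : NeZero cB := ⟨hB.ne'⟩
  set g₀ := Nat.gcd cA cB with hg₀
  have hg₀pos : 0 < g₀ := Nat.gcd_pos_of_pos_left cB hA
  have hg₀A : g₀ ∣ cA := Nat.gcd_dvd_left cA cB
  have hg₀B : g₀ ∣ cB := Nat.gcd_dvd_right cA cB
  -- numerator `cA/g₀` and denominator `cB/g₀` both divide `n`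
  have key : ∀ {c c' : ℕ} [NeZero c] [NeZero c'] (f' : ZMod c →+ ZMod c') (g' : ZMod c' →+ ZMod c),
      (∀ x, g' (f' x) = n • x) → Nat.gcd c c' ∣ c → Nat.gcd c c' ∣ c' → 0 < Nat.gcd c c' →
      c / Nat.gcd c c' ∣ n := by
    intro c c' _ _ f' g' h hgc hgc' hgpos
    -- `c / gcd(c, n) ∣ gcd(c, c')`, hence `c = (c/gcd(c,n)) gcd(c,n) ∣ gcd(c,c') · n`
    have h1 : c / Nat.gcd c n ∣ Nat.gcd c c' :=
      Nat.dvd_gcd (Nat.div_dvd_of_dvd (Nat.gcd_dvd_left c n))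
        (div_gcd_dvd_of_comp_eq_nsmul n f' g' h)
    have h2 : c ∣ Nat.gcd c c' * n := by
      calc c = c / Nat.gcd c n * Nat.gcd c n := (Nat.div_mul_cancel (Nat.gcd_dvd_left c n)).symm
        _ ∣ Nat.gcd c c' * n := Nat.mul_dvd_mul h1 (Nat.gcd_dvd_right c n)
    refine Nat.dvd_of_mul_dvd_mul_right hgpos ?_
    rwa [Nat.div_mul_cancel hgc, mul_comm]
  have ha : cA / g₀ ∣ n := key f g hgf hg₀A hg₀B hg₀pos
  have hb : cB / g₀ ∣ n := by
    have := key g f hfg (Nat.gcd_comm cA cB ▸ hg₀B) (Nat.gcd_comm cA cB ▸ hg₀A)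
      (Nat.gcd_comm cA cB ▸ hg₀pos)
    rwa [Nat.gcd_comm] at this
  have hapos : 0 < cA / g₀ := Nat.div_pos (Nat.le_of_dvd hA hg₀A) hg₀pos
  have hbpos : 0 < cB / g₀ := Nat.div_pos (Nat.le_of_dvd hB hg₀B) hg₀pos
  refine ⟨cA / g₀, cB / g₀, hapos, Nat.le_of_dvd hn ha, hbpos, Nat.le_of_dvd hn hb, ?_⟩
  rw [← Nat.mul_div_assoc _ hg₀B, Nat.div_mul_right_comm hg₀A]

end Literature.NumberTheory.Automorphic

end
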